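import Literature.NumberTheory.Automorphic.AdmissibleTorusOrbit
import Literature.NumberTheory.Automorphic.BorelGoodPlaceHecke
import Literature.NumberTheory.Automorphic.TameLevelScalarFactorisation
import Literature.NumberTheory.Automorphic.BorelGoodPlacePushPull
import Literature.NumberTheory.Automorphic.BorelEigenvalueFactorisation
import HarnessLib

/-!
# The admissible torus elements factor through the good-place Hecke elements `t^B_2`

Topic `NumberTheory/Automorphic`; namespace `Literature.NumberTheory.Automorphic.BigHeckeGLn`.
A *proofs* file (theorems and auxiliary definitions with bodies).

For `x ∈ 𝓞_K ∖ 0` prime to `S ⊇ {v ∣ 𝔫}` with `x ≡ 1 mod 𝔫` ("admissible") the torus element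
`ι(diag(1, x)) ∈ GL₂(𝔸_K^∞)` is, up to a factor in `K_f(𝔫)`, the product over the places `w ∣ (x)`
(all outside `S`) of the `ord_w(x)`-th powers of the local elements `ι_w(diag(1, ϖ_w))`
(`torusPart`), `torusRemainder_mem_comap_principalCongruenceLevel`; in the subgroup `H_S`
(`BorelGoodPlaceModel`) this reads `ι(t_x) = ∏_w (t^B_{2,w})^{ord_w x} · u` with `u ∈ U ∩ H_S` for any
level `U ⊇ K_f(𝔫)` (`admissibleDiagH_eq_torusWord_mul`).  Hence the Hecke operator of `ι(t_x)` on the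
Borel model is the corresponding product of the `T^B_{e₂,w}` (multiplicativity of the Hecke
operators of level-contracting elements) — the torus eigenvalue `M(x) = ∏_w μ_w^{ord_w x}` of
[Harder1987, §2].

## References

* G. Harder, *Eisenstein cohomology of arithmetic groups. The case GL₂*, Invent. Math. 89 (1987), §2.
  [Harder1987]
-/

noncomputable section

open scoped NumberField
open IsDedekindDomain CategoryTheory

namespace Literature.NumberTheory.Automorphic.BigHeckeGLn

variable {K : Type} [Field K] [NumberField K]

/-! ### Local diagonal units -/

/-- `diag(1, u) ∈ GL₂(𝒪_v) = K_v(1)` for a local unit `u`, `|u|_v = 1`. [folklore] -/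
theorem glDiagonal_one_unit_mem_valuedCongruenceSubgroup_one {v : HeightOneSpectrum (𝓞 K)}
    (u : (v.adicCompletion K)ˣ) (hu : Valued.v (u : v.adicCompletion K) = 1) :
    glDiagonal 2 (v.adicCompletion K) ![1, u] ∈
      valuedCongruenceSubgroup (Fin 2) (1 : WithZero (Multiplicative ℤ)) := by
  have hval : ∀ i : Fin 2, Valued.v ((![1, u] i : (v.adicCompletion K)ˣ) : v.adicCompletion K) = 1 := by
    intro i; fin_cases i
    · simp
    · simpa using hu
  have hvalinv : ∀ i : Fin 2, Valued.v (((![1, u] i)⁻¹ : (v.adicCompletion K)ˣ) : v.adicCompletion K) = 1 := by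
    intro i
    rw [Units.val_inv_eq_inv_val, map_inv₀, hval, inv_one]
  rw [mem_valuedCongruenceSubgroup_iff]
  refine ⟨fun i j => ?_, fun i j => ?_, fun i j => ?_⟩
  · rw [coe_glDiagonal, Matrix.diagonal_apply]
    split_ifs
    · exact (hval i).le
    · simp
  · rw [← map_inv, coe_glDiagonal, Matrix.diagonal_apply]
    split_ifs
    · exact (hvalinv i).le
    · simp
  · rw [Matrix.sub_apply, coe_glDiagonal, Matrix.diagonal_apply, Matrix.one_apply]
    split_ifs
    · refine (Valued.v.map_sub _ _).trans ?_
      rw [hval, Valued.v.map_one, max_self]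
    · simp

/-! ### The torus word and the remainder -/

/-- The places dividing `(x)`, as a `Finset`. [folklore] -/
def suppOf (x : 𝓞 K) (hx : x ≠ 0) : Finset (HeightOneSpectrum (𝓞 K)) :=
  (Ideal.finite_factors ((Ideal.span_singleton_eq_bot.not).2 hx : Ideal.span {x} ≠ ⊥)).toFinset

/-- Membership in `suppOf`. [folklore] -/
theorem mem_suppOf {x : 𝓞 K} (hx : x ≠ 0) {w : HeightOneSpectrum (𝓞 K)} :
    w ∈ suppOf x hx ↔ w.asIdeal ∣ Ideal.span {x} := by
  rw [suppOf, Set.Finite.mem_toFinset]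
  rfl

/-- `t₂ = diag(1, ϖ_w)` as a `glDiagonal`. [folklore] -/
theorem localT₂_eq_glDiagonal (w : HeightOneSpectrum (𝓞 K)) :
    localT₂ (K := K) w = glDiagonal 2 (w.adicCompletion K) ![1, uniformizerAt w] := by
  refine Matrix.GeneralLinearGroup.ext fun i j => ?_
  rw [coe_glDiagonal, coe_heckeLocalDiag']
  fin_cases i <;> fin_cases j <;> simp

/-- Powers of `t₂`: `t₂ⁿ = diag(1, ϖ_wⁿ)`. [folklore] -/
theorem localT₂_pow (w : HeightOneSpectrum (𝓞 K)) (m : ℕ) :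
    localT₂ (K := K) w ^ m = glDiagonal 2 (w.adicCompletion K) ![1, uniformizerAt w ^ m] := by
  rw [localT₂_eq_glDiagonal, ← map_pow]
  congr 1
  funext k
  fin_cases k <;> simp

/-- **The torus word** `∏_{w ∣ (x)} ι_w(diag(1, ϖ_w))^{ord_w x} ∈ GL₂(𝔸_K^∞)`. [cite: Harder1987, §2] -/
def torusPart (x : 𝓞 K) (hx : x ≠ 0) : FiniteAdelicGL 2 K :=
  ((suppOf x hx).toList.map fun w => ofLocal 2 K w (localT₂ w ^ ordAt w x)).prod

/-- Local components of the torus word at `w ∣ (x)`. [folklore] -/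
theorem localComponent_torusPart_of_mem {x : 𝓞 K} (hx : x ≠ 0) {w : HeightOneSpectrum (𝓞 K)}
    (hw : w ∈ suppOf x hx) :
    localComponent 2 K w (torusPart x hx) = glDiagonal 2 (w.adicCompletion K) ![1, uniformizerAt w ^ ordAt w x] := by
  classical
  rw [torusPart, localComponent_list_prod_ofLocal w (fun v => localT₂ v ^ ordAt v x) (suppOf x hx).toList
    (Finset.nodup_toList _), if_pos (Finset.mem_toList.2 hw), localT₂_pow]

/-- Local components of the torus word at `w ∤ (x)`. [folklore] -/
theorem localComponent_torusPart_of_not_mem {x : 𝓞 K} (hx : x ≠ 0) {w : HeightOneSpectrum (𝓞 K)}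
    (hw : w ∉ suppOf x hx) : localComponent 2 K w (torusPart x hx) = 1 := by
  classical
  rw [torusPart, localComponent_list_prod_ofLocal w (fun v => localT₂ v ^ ordAt v x) (suppOf x hx).toList
    (Finset.nodup_toList _), if_neg (fun h => hw (Finset.mem_toList.1 h))]

/-- The local component of `ι(diag(1, x))`. [folklore] -/
theorem localComponent_admissibleDiag (x : K) (hx : x ≠ 0) (w : HeightOneSpectrum (𝓞 K)) :
    localComponent 2 K w (admissibleDiag x hx) =
      glDiagonal 2 (w.adicCompletion K) ![1, Units.map (algebraMap K (w.adicCompletion K) : K →* _) (Units.mk0 x hx)] := by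
  rw [admissibleDiag, localComponent_globalEmbedding, diagOneX, map_glDiagonal_eq]
  congr 1
  funext k
  fin_cases k <;> simp

/-- **The remainder** `u_x = (torus word)⁻¹ · ι(diag(1, x))`. [folklore] -/
def torusRemainder (x : 𝓞 K) (hx : x ≠ 0) : FiniteAdelicGL 2 K :=
  (torusPart x hx)⁻¹ * admissibleDiag (x : K) (by exact_mod_cast hx)

/-- `ι(diag(1, x)) = (torus word) · u_x`. [folklore] -/
theorem admissibleDiag_eq_torusPart_mul (x : 𝓞 K) (hx : x ≠ 0) :
    admissibleDiag (x : K) (by exact_mod_cast hx) = torusPart x hx * torusRemainder x hx := by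
  rw [torusRemainder, mul_inv_cancel_left]

/-- The local component of `u_x` at `w ∤ 𝔫`-type places is `diag(1, ϖ_w^{-ord_w x} x)`, a unit
diagonal. [folklore] -/
theorem localComponent_torusRemainder_mem_one {x : 𝓞 K} (hx : x ≠ 0) (w : HeightOneSpectrum (𝓞 K)) :
    localComponent 2 K w (torusRemainder x hx) ∈
      valuedCongruenceSubgroup (Fin 2) (1 : WithZero (Multiplicative ℤ)) := by
  classical
  have hxK : (x : K) ≠ 0 := by exact_mod_cast hx
  rw [torusRemainder, map_mul, map_inv, localComponent_admissibleDiag]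
  by_cases hw : w ∈ suppOf x hx
  · rw [localComponent_torusPart_of_mem hx hw, ← map_inv, ← map_mul]
    have heq : (![1, uniformizerAt w ^ ordAt w x])⁻¹ *
        ![1, Units.map (algebraMap K (w.adicCompletion K) : K →* _) (Units.mk0 (x : K) hxK)] =
        ![1, (uniformizerAt w ^ ordAt w x)⁻¹ *
          Units.map (algebraMap K (w.adicCompletion K) : K →* _) (Units.mk0 (x : K) hxK)] := by
      funext k
      fin_cases k <;> simp
    rw [heq]
    refine glDiagonal_one_unit_mem_valuedCongruenceSubgroup_one _ ?_
    rw [Units.val_mul, Units.val_inv_eq_inv_val, map_mul, map_inv₀, Units.val_pow_eq_pow_val, map_pow,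
      valued_coe_uniformizerAt]
    change _ * Valued.v (algebraMap K (w.adicCompletion K) (x : K)) = 1
    rw [valued_algebraMap_eq w hx, ← WithZero.exp_nsmul, ← WithZero.exp_neg, ← WithZero.exp_add]
    simp
  · rw [localComponent_torusPart_of_not_mem hx hw, inv_one, one_mul]
    refine glDiagonal_one_unit_mem_valuedCongruenceSubgroup_one _ ?_
    change Valued.v (algebraMap K (w.adicCompletion K) (x : K)) = 1
    rw [valued_algebraMap_eq w hx]
    have h0 : ordAt w x = 0 := by
      by_contra h
      exact hw ((mem_suppOf hx).2 ((ordAt_ne_zero_iff w hx).1 h))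
    rw [h0]
    simp

/-- **`u_x ∈ K_f(𝔫)`** for admissible `x` (`x ≡ 1 mod 𝔫`, `x` prime to the primes of `𝔫`).
[cite: Harder1987, §2] -/
theorem torusRemainder_mem_comap_principalCongruenceLevel {𝔫 : Ideal (𝓞 K)} (h𝔫 : 𝔫 ≠ 0) {x : 𝓞 K}
    (hx : x ≠ 0) (hx1 : x - 1 ∈ 𝔫) (hx𝔫 : ∀ w : HeightOneSpectrum (𝓞 K), w.asIdeal ∣ 𝔫 → ¬ w.asIdeal ∣ Ideal.span {x}) :
    torusRemainder x hx ∈ (principalCongruenceLevel 2 K 𝔫).comap (GLn.ofFinite 2 K) := by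
  classical
  rw [mem_comap_principalCongruenceLevel_iff_localComponent]
  intro v
  by_cases hv : v.asIdeal ∣ 𝔫
  · -- at `v ∣ 𝔫` the torus word is trivial and `ι(t_x)_v ∈ K_v(𝔫)`
    have hvs : v ∉ suppOf x hx := fun h => hx𝔫 v hv ((mem_suppOf hx).1 h)
    rw [torusRemainder, map_mul, map_inv, localComponent_torusPart_of_not_mem hx hvs, inv_one, one_mul]
    exact localComponent_admissibleDiag_mem h𝔫 x (by exact_mod_cast hx) hx1 hv
  · rw [idealRadius_eq_one_of_not_dvd h𝔫 hv]
    exact localComponent_torusRemainder_mem_one hx v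

/-! ### In the subgroup `H_S` -/

section InH

variable (S : Set (HeightOneSpectrum (𝓞 K)))

/-- `ι(diag(1, x)) ∈ H_S`. [folklore] -/
theorem admissibleDiag_mem_borelAwayFrom (x : K) (hx : x ≠ 0) : admissibleDiag x hx ∈ borelAwayFrom (n := 2) S := by
  rw [admissibleDiag_eq_glDiagonal]
  refine mem_borelAwayFrom_of_blockTriangular ?_ S
  rw [coe_glDiagonal]
  exact Matrix.blockTriangular_diagonal _

/-- **The admissible torus element as an element of `H_S`.** [cite: Harder1987, §2] -/
def admissibleDiagH (x : K) (hx : x ≠ 0) : borelAwayFrom (n := 2) S :=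
  ⟨admissibleDiag x hx, admissibleDiag_mem_borelAwayFrom S x hx⟩

/-- Unfolding lemma. [folklore] -/
@[simp]
theorem coe_admissibleDiagH (x : K) (hx : x ≠ 0) :
    ((admissibleDiagH S x hx : borelAwayFrom (n := 2) S) : FiniteAdelicGL 2 K) = admissibleDiag x hx := rfl

/-- **The torus word in `H_S`**: `∏_{w ∣ (x)} (t^B_{2,w})^{ord_w x}`. [cite: Harder1987, §2] -/
def torusWord (x : 𝓞 K) (hx : x ≠ 0) : borelAwayFrom (n := 2) S :=
  ((suppOf x hx).toList.map fun w => borelHeckeElement₂ S w ^ ordAt w x).prod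

/-- The torus word of `H_S` is the torus word of `GL₂(𝔸_K^∞)`. [folklore] -/
theorem coe_torusWord (x : 𝓞 K) (hx : x ≠ 0) :
    ((torusWord S x hx : borelAwayFrom (n := 2) S) : FiniteAdelicGL 2 K) = torusPart x hx := by
  rw [torusWord, torusPart, ← Subgroup.coe_subtype, map_list_prod, List.map_map]
  congr 1
  refine List.map_congr_left fun w _ => ?_
  rw [Function.comp_apply, map_pow, Subgroup.coe_subtype, coe_borelHeckeElement₂, map_pow]

/-- **`ι(t_x) = (torus word) · u` with `u ∈ U ∩ H_S`** for every level `U ⊇ K_f(𝔫)` and admissible `x`.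
[cite: Harder1987, §2] -/
theorem torusWord_inv_mul_admissibleDiagH_mem {𝔫 : Ideal (𝓞 K)} (h𝔫 : 𝔫 ≠ 0)
    {U : Subgroup (FiniteAdelicGL 2 K)} (hU : (principalCongruenceLevel 2 K 𝔫).comap (GLn.ofFinite 2 K) ≤ U)
    {x : 𝓞 K} (hx : x ≠ 0) (hx1 : x - 1 ∈ 𝔫)
    (hx𝔫 : ∀ w : HeightOneSpectrum (𝓞 K), w.asIdeal ∣ 𝔫 → ¬ w.asIdeal ∣ Ideal.span {x}) :
    (torusWord S x hx)⁻¹ * admissibleDiagH S (x : K) (by exact_mod_cast hx) ∈ U.subgroupOf (borelAwayFrom S) := by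
  rw [Subgroup.mem_subgroupOf, Subgroup.coe_mul, Subgroup.coe_inv, coe_torusWord, coe_admissibleDiagH]
  exact hU (torusRemainder_mem_comap_principalCongruenceLevel h𝔫 hx hx1 hx𝔫)

end InH

end Literature.NumberTheory.Automorphic.BigHeckeGLn

/-! ### Multiplicativity of the Hecke operators of level-contracting elements (twisted coefficients) -/

namespace Literature.NumberTheory.Automorphic.TwistedQuotient

variable {k : Type} [CommRing k] {Γ 𝒢 : Type} [Group Γ] [Group 𝒢] (ι : Γ →* 𝒢) (L : Subgroup 𝒢)
  {V : Type} [AddCommGroup V] [Module k V] (ρ : Representation k Γ V)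

/-- `T_g = 1` on `Fun(𝒢 ⧸ L, V)` for `g ∈ L`. [folklore] -/
theorem heckeRepHom_eq_id_of_mem {g : 𝒢} (hg : g ∈ L) : heckeRepHom ι L ρ g = 𝟙 (coeffRep ι L ρ) := by
  refine Rep.hom_ext (Representation.IntertwiningMap.ext (LinearMap.ext fun f => funext fun c => ?_))
  change ArithmeticQuotient.heckeFun k L g V f c = f c
  induction c using QuotientGroup.induction_on with
  | H y =>
    rw [ArithmeticQuotient.heckeFun_apply_mk_of_conj k V (fun l hl => mul_mem (mul_mem (inv_mem hg) hl) hg) f y]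
    congr 1
    exact QuotientGroup.eq.2 (by simpa using inv_mem hg)

/-- `T_1 = 1` on `H^q(S_L, Ṽ)`. [folklore] -/
theorem heckeEnd_one (q : ℕ) : heckeEnd ι L ρ 1 q = 1 := by
  rw [Module.End.one_eq_id]
  change (heckeOperator ι L ρ 1 q).hom = _
  rw [heckeOperator_one, ModuleCat.hom_id]

/-- **`T_g = 1` on `H^q(S_L, Ṽ)` for `g ∈ L`.** [folklore] -/
theorem heckeEnd_eq_one_of_mem {g : 𝒢} (hg : g ∈ L) (q : ℕ) : heckeEnd ι L ρ g q = 1 := by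
  have h : heckeOperator ι L ρ g q = 𝟙 (cohomology ι L ρ q) := by
    simp only [heckeOperator, heckeRepHom_eq_id_of_mem ι L ρ hg, groupCohomology.map_id]
  rw [Module.End.one_eq_id]
  change (heckeOperator ι L ρ g q).hom = _
  rw [h, ModuleCat.hom_id]

variable {L} in
/-- `T_{g g'} = T_{g'} ≫ T_g` on `Fun(𝒢 ⧸ L, V)` for level-contracting `g, g'`. [folklore] -/
theorem heckeRepHom_mul_of_conj {g g' : 𝒢} (hg : ∀ l ∈ L, g⁻¹ * l * g ∈ L) (hg' : ∀ l ∈ L, g'⁻¹ * l * g' ∈ L) :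
    heckeRepHom ι L ρ (g * g') = heckeRepHom ι L ρ g' ≫ heckeRepHom ι L ρ g := by
  refine Rep.hom_ext (Representation.IntertwiningMap.ext (LinearMap.ext fun f => ?_))
  change ArithmeticQuotient.heckeFun k L (g * g') V f =
    ArithmeticQuotient.heckeFun k L g V (ArithmeticQuotient.heckeFun k L g' V f)
  rw [ArithmeticQuotient.heckeFun_mul_of_conj k V hg hg', LinearMap.comp_apply]

variable {L} in
/-- **`T_{g g'} = T_g ∘ T_{g'}` on `H^q(S_L, Ṽ)`** for level-contracting `g, g'`. [folklore] -/
theorem heckeEnd_mul_of_conj {g g' : 𝒢} (hg : ∀ l ∈ L, g⁻¹ * l * g ∈ L) (hg' : ∀ l ∈ L, g'⁻¹ * l * g' ∈ L)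
    (q : ℕ) : heckeEnd ι L ρ (g * g') q = heckeEnd ι L ρ g q * heckeEnd ι L ρ g' q := by
  refine LinearMap.ext fun x => ?_
  rw [Module.End.mul_apply]
  change (groupCohomology.map (MonoidHom.id Γ) (heckeRepHom ι L ρ (g * g')) q).hom x =
    (heckeOperator ι L ρ g' q ≫ heckeOperator ι L ρ g q).hom x
  rw [heckeRepHom_mul_of_conj ι ρ hg hg', heckeOperator, heckeOperator, ← groupCohomology.map_id_comp]

variable {L} in
/-- Products of level-contracting elements are level-contracting. [folklore] -/
theorem conj_mem_of_list_prod (l : List 𝒢) (hl : ∀ g ∈ l, ∀ m ∈ L, g⁻¹ * m * g ∈ L) :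
    ∀ m ∈ L, l.prod⁻¹ * m * l.prod ∈ L := by
  induction l with
  | nil => intro m hm; simpa using hm
  | cons g l ih =>
    intro m hm
    have hg := hl g List.mem_cons_self
    have ih' := ih (fun g' hg' => hl g' (List.mem_cons_of_mem _ hg'))
    rw [List.prod_cons, mul_inv_rev,
      show l.prod⁻¹ * g⁻¹ * m * (g * l.prod) = l.prod⁻¹ * (g⁻¹ * m * g) * l.prod by group]
    exact ih' _ (hg m hm)

variable {L} in
/-- Powers of a level-contracting element are level-contracting. [folklore] -/
theorem conj_mem_of_pow {g : 𝒢} (hg : ∀ m ∈ L, g⁻¹ * m * g ∈ L) (n : ℕ) :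
    ∀ m ∈ L, (g ^ n)⁻¹ * m * g ^ n ∈ L := by
  have h := conj_mem_of_list_prod (List.replicate n g) (fun g' hg' => by rwa [List.eq_of_mem_replicate hg'])
  rwa [List.prod_replicate] at h

variable {L} in
/-- `T_{gⁿ} = T_gⁿ` for level-contracting `g`. [folklore] -/
theorem heckeEnd_pow_of_conj {g : 𝒢} (hg : ∀ m ∈ L, g⁻¹ * m * g ∈ L) (q n : ℕ) :
    heckeEnd ι L ρ (g ^ n) q = heckeEnd ι L ρ g q ^ n := by
  induction n with
  | zero => rw [pow_zero, pow_zero, heckeEnd_one]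
  | succ n ih => rw [pow_succ, heckeEnd_mul_of_conj ι ρ (conj_mem_of_pow hg n) hg, ih, pow_succ]

variable {L} in
/-- `T_{∏ gᵢ} = ∏ T_{gᵢ}` for a list of level-contracting elements. [folklore] -/
theorem heckeEnd_list_prod_of_conj (l : List 𝒢) (hl : ∀ g ∈ l, ∀ m ∈ L, g⁻¹ * m * g ∈ L) (q : ℕ) :
    heckeEnd ι L ρ l.prod q = (l.map fun g => heckeEnd ι L ρ g q).prod := by
  induction l with
  | nil => rw [List.prod_nil, List.map_nil, List.prod_nil, heckeEnd_one]
  | cons g l ih =>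
    rw [List.prod_cons, List.map_cons, List.prod_cons,
      heckeEnd_mul_of_conj ι ρ (hl g List.mem_cons_self)
        (conj_mem_of_list_prod l fun g' hg' => hl g' (List.mem_cons_of_mem _ hg')),
      ih fun g' hg' => hl g' (List.mem_cons_of_mem _ hg')]

end Literature.NumberTheory.Automorphic.TwistedQuotient

/-! ### The Hecke operator of `ι(t_x)` on the Borel model -/

namespace Literature.NumberTheory.Automorphic.BigHeckeGLn

variable {K : Type} [Field K] [NumberField K]
variable (S : Set (HeightOneSpectrum (𝓞 K))) (U : Subgroup (FiniteAdelicGL 2 K))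
  {E : Type} [Field E] {Γ : Type} [Group Γ]
  (ι : Γ →* FiniteAdelicGL 2 K) (hι : ∀ γ, ι γ ∈ borelAwayFrom (n := 2) S)
  {V : Type} [AddCommGroup V] [Module E V] (ρ : Representation E Γ V) (q : ℕ)

/-- **`T^B_{ι(t_x)} = ∏_{w ∣ (x)} (T^B_{e₂,w})^{ord_w x}` on the Borel model** for admissible `x`
(`x ∈ 𝓞_K ∖ 0`, `x ≡ 1 mod 𝔫`, `x` prime to `S ⊇ {v ∣ 𝔫}`), `U ⊇ K_f(𝔫)` unramified away from `S`.
[cite: Harder1987, §2] -/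
theorem borelModelHecke_admissibleDiagH {𝔫 : Ideal (𝓞 K)} (h𝔫 : 𝔫 ≠ 0)
    (hU𝔫 : (principalCongruenceLevel 2 K 𝔫).comap (GLn.ofFinite 2 K) ≤ U)
    (hS : ∀ v : HeightOneSpectrum (𝓞 K), v.asIdeal ∣ 𝔫 → v ∈ S)
    (hU : ∀ w, w ∉ S → ArithmeticQuotient.IsUnramifiedLevel
      (valuedCongruenceSubgroup (Fin 2) (1 : WithZero (Multiplicative ℤ))) (ofLocal 2 K w) (localComponent 2 K w) U)
    {x : 𝓞 K} (hx : x ≠ 0) (hx1 : x - 1 ∈ 𝔫) (hxS : ∀ w ∈ S, ¬ w.asIdeal ∣ Ideal.span {x}) :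
    borelModelHecke S U ι hι ρ q (admissibleDiagH S (x : K) (by exact_mod_cast hx)) =
      ((suppOf x hx).toList.map fun w => borelModelHecke S U ι hι ρ q (borelHeckeElement₂ S w) ^ ordAt w x).prod := by
  have hx𝔫 : ∀ w : HeightOneSpectrum (𝓞 K), w.asIdeal ∣ 𝔫 → ¬ w.asIdeal ∣ Ideal.span {x} :=
    fun w hw => hxS w (hS w hw)
  -- the places of `(x)` lie outside `S`
  have hsupp : ∀ w ∈ suppOf x hx, w ∉ S := fun w hw hwS => hxS w hwS ((mem_suppOf hx).1 hw)
  have hcontr : ∀ g ∈ (suppOf x hx).toList.map (fun w => borelHeckeElement₂ S w ^ ordAt w x),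
      ∀ m ∈ U.subgroupOf (borelAwayFrom S), g⁻¹ * m * g ∈ U.subgroupOf (borelAwayFrom S) := by
    intro g hg
    obtain ⟨w, hw, rfl⟩ := List.mem_map.1 hg
    have hwS : w ∉ S := hsupp w (Finset.mem_toList.1 hw)
    exact TwistedQuotient.conj_mem_of_pow (borelHeckeElement₂_conj_mem hwS (hU w hwS)) _
  set u := (torusWord S x hx)⁻¹ * admissibleDiagH S (x : K) (by exact_mod_cast hx) with hu
  have huU : u ∈ U.subgroupOf (borelAwayFrom S) := torusWord_inv_mul_admissibleDiagH_mem S h𝔫 hU𝔫 hx hx1 hx𝔫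
  have hdec : admissibleDiagH S (x : K) (by exact_mod_cast hx) = torusWord S x hx * u := by
    rw [hu, mul_inv_cancel_left]
  have huconj : ∀ m ∈ U.subgroupOf (borelAwayFrom S), u⁻¹ * m * u ∈ U.subgroupOf (borelAwayFrom S) :=
    fun m hm => mul_mem (mul_mem (inv_mem huU) hm) huU
  rw [hdec]
  unfold borelModelHecke
  rw [torusWord, TwistedQuotient.heckeEnd_mul_of_conj _ ρ (TwistedQuotient.conj_mem_of_list_prod _ hcontr) huconj,
    TwistedQuotient.heckeEnd_eq_one_of_mem _ _ ρ huU, mul_one,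
    TwistedQuotient.heckeEnd_list_prod_of_conj _ ρ _ hcontr, List.map_map]
  congr 1
  refine List.map_congr_left fun w hw => ?_
  rw [Function.comp_apply,
    TwistedQuotient.heckeEnd_pow_of_conj _ ρ (borelHeckeElement₂_conj_mem (hsupp w (Finset.mem_toList.1 hw))
      (hU w (hsupp w (Finset.mem_toList.1 hw))))]

end Literature.NumberTheory.Automorphic.BigHeckeGLn
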